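import Summits.BirchSwinnertonDyer.BirchSwinnertonDyer.Theorems.KatoDescentPotSupersingularZetaBodyScaling
import Summits.BirchSwinnertonDyer.Rank1Residual.GaloisImage.KatoKuriharaValueEmptyLevel
import HarnessLib

/-!
# Rank-ONE decoupling of the tree's Kato zeta data (`Kato2004.ZetaBody`): LEVEL-WISE rescaling
# of the value functionals, and — when the bottom value vanishes (`L(f,1) = 0`) — scaling of the
# classes with the constant `κ` AND the bottom functional `Λ_{0,∅}` FIXED, free replacement of
# `Λ_{0,∅}` (tightness of the typer request of memo v9 for K9 `WildRankOne` 19200 / KT `TameRankOne` 19984)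

Cell `bsd-potss` (FULL-BSD rank ≤ 1, tranche 1b), seat `bsd-potss-kmc`, generation 11, PART 18a; memo
HOME/bsd-potss-kmc/KMC-DESCENT-MEMO-v10.md §1.  ROUTE-FREE; `--supports stmt-BirchSwinnertonDyer-19200`.
Successor of PART 17c (`ZetaBodyScaling.zetaBody_smul`, p469611: `(κ, Λ, z, x) ↦ (n·κ, Λ, n•z, n·x)`).

WHAT THIS SHOWS.  `ZetaBody W p f ι κ Λ c d a A z x` carries ONE real constant `κ` for all levels but
NO cross-level axiom on the value functionals `Λ_{k,r}` (design B5 / rider R-ι of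
`Kato2004/EulerSystemValues.lean`).  Hence (`zetaBody_rescale`): for scalars `e_{k,r} ∈ ℚ_p`, `n ∈ ℕ`,
`s ∈ ℚ` with `e_{k,r}·n = s` at every level whose value `x_{k,r}` is non-zero (no condition where
`x_{k,r} = 0`), the datum `(s·κ, (e_{k,r}•Λ_{k,r}), n•z, s·x)` again satisfies `ZetaBody`.  Special cases:
PART 17c's homogeneity (`e ≡ 1`, `s = n`); and, AT A LEVEL WHERE THE VALUE VANISHES, complete freedom
of that level's functional.  The bottom level `(k, r) = (0, ∅)` (`m = 1`, the field `ℚ`) has the value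
`x_{0,∅} = κ · L_{(pA)}(f,1)/Ω⁺_f · R⁻` (value law (C5) at the trivial character; tree
`KatoValue.zetaBody_value_level_one`), which VANISHES exactly in the situation of the rank-one
residuals (`L(f,1) = 0`; `bottomValue_eq_zero_of_depletedL_one_eq_zero`).  Then:
* `zetaBody_smul_offBottom`: the classes scale `z ↦ n•z` (so the `Λ`-adic lift `𝐲 ↦ n•𝐲`,
  `ZetaBodyScaling.zetaLift_smul`, and the position of `𝐲₀` in `H¹_f(ℚ,T)/tors` shifts by `v_p n`)
  while `κ`, the values `x` AND the bottom functional `Λ_{0,∅}` stay FIXED — only the functionals at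
  the levels `m > 1` are divided by `n`;
* `zetaBody_replaceBottom` / `zetaBody_bottom_smul`: `Λ_{0,∅}` may be replaced by ANY
  `Gal`-equivariant functional local at `p` that kills `z_{0,∅}` — e.g. by `t • Λ_{0,∅}` for any
  `t ∈ ℚ_p` including `t = 0` — with everything else unchanged.
CONSEQUENCE (memo v10 §1–§2; nothing about BSD is asserted here).  Any clause written on the pair
`(κ, Λ_{0,∅})` and objects intrinsic to `W` at the bottom level — the local Tate pairing on
`H¹(ℚ_p, T_pW)`, the Kummer map and `log_ω` (the «adjointness clause» (a) of memo v9 §0 / INBOX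
2026-08-26T21:56Z), the image lattice `exp*_ω(H¹(ℚ_p,T_pW)) = c_p·p^{−τ}ℤ_p` (Kim §3.2.3), or a DEFINED
`exp*_ω` substituted for `Λ_{0,∅}` alone (option (b) at the bottom level) — is satisfied by the datum
with classes `n•z` whenever it is by `z`: it does NOT pin the scale of Kato's classes in analytic rank
one, hence not `pos(𝐲₀)`, hence neither the Perrin-Riou node nor «12.10 at `X = 0`».  What pins them is a
LEVEL-UNIFORM characterisation of the `Λ_{k,∅}` at the `p`-power levels where twisted values are
non-zero (a defined dual exponential on `H¹(ℚ(ζ_{p^k}) ⊗ ℚ_p, V)` for all `k`, i.e. `D_dR`/Coleman-map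
class infrastructure), or cross-level axioms strong enough to transport such a normalisation down to
`m = 1` (memo v10 §2 shows trace-compatibility alone is not).  In rank ZERO none of this arises:
`x_{0,∅} ≠ 0` ties `Λ_{0,∅}` to `κ` directly.

References: K. Kato, Astérisque 295 (2004) §9.4, Thm. 9.7, Thm. 6.6 (1), Thm. 12.5 (1), §13.1
[Kato2004Asterisque]; D. Burns, M. Kurihara, T. Sano, arXiv:1910.07404, Hyp. 2.2 / Rem. 2.3, Conj. 2.8
[BurnsKuriharaSano2019]; C.-H. Kim, AJM 148 (2026) §3.2.3 [Kim2022StructureSelmer]; tree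
`Kato2004/EulerSystemValues.lean` (`ZetaBody`, B5, R-ι, (P2)), `Theorems/…ZetaBodyScaling` (PART 17c),
`Rank1Residual/GaloisImage/KatoKuriharaValueEmptyLevel` (`zetaBody_value_level_one`).
-/

set_option autoImplicit false
set_option linter.dupNamespace false

noncomputable section

open scoped NumberField TensorProduct Pointwise Classical
open Field IsDedekindDomain CongruenceSubgroup
open Literature.NumberTheory.GaloisRepresentations
open Literature.NumberTheory.EllipticCurves Literature.NumberTheory.EllipticCurves.ModularForms
open Literature.NumberTheory.EllipticCurves.Kato2004
open Literature.NumberTheory.EllipticCurves.Kato2004.EulerSystemValues Rat.HeightOneSpectrum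

namespace Summit.BirchSwinnertonDyer.BirchSwinnertonDyer.Theorems.ZetaBodyScaling

/-! ## §0 Scalar bookkeeping in `ℚ_p ⊗_ℚ ℚ(ζ_m)` and for Kato's character sums -/

section Scalars

variable {p : ℕ} [Fact p.Prime]

/-- The Galois transport `1 ⊗ σ` on `ℚ_p ⊗_ℚ K` (the map of (C3a)) commutes with the `ℚ_p`-scalars:
`(1 ⊗ σ)(t • u) = t • (1 ⊗ σ)(u)` (`t • u = (t ⊗ 1)·u` and `1 ⊗ σ` is multiplicative). [folklore] -/
theorem map_id_smul {K : Type*} [Field K] [Algebra ℚ K] (σ : K →ₐ[ℚ] K) (t : ℚ_[p])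
    (u : ℚ_[p] ⊗[ℚ] K) :
    Algebra.TensorProduct.map (AlgHom.id ℚ ℚ_[p]) σ (t • u) =
      t • Algebra.TensorProduct.map (AlgHom.id ℚ ℚ_[p]) σ u := by
  rw [Algebra.smul_def, Algebra.smul_def, map_mul]
  congr 1
  rw [Algebra.TensorProduct.algebraMap_apply, Algebra.TensorProduct.map_tmul, map_one, AlgHom.id_apply]

/-- `e • (n • (1 ⊗ y)) = 1 ⊗ (s·y)` in `ℚ_p ⊗_ℚ K` when `e·n = s` (`e ∈ ℚ_p`, `n ∈ ℕ`, `s ∈ ℚ`).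
[folklore] -/
theorem smul_natCast_smul_one_tmul {K : Type*} [Field K] [Algebra ℚ K] {e : ℚ_[p]} {n : ℕ} {s : ℚ}
    (hes : e * (n : ℚ_[p]) = (s : ℚ_[p])) (y : K) :
    e • ((n : ℤ_[p]) • ((1 : ℚ_[p]) ⊗ₜ[ℚ] y)) = (1 : ℚ_[p]) ⊗ₜ[ℚ] ((s : K) * y) := by
  have h1 : (n : ℤ_[p]) • ((1 : ℚ_[p]) ⊗ₜ[ℚ] y) = (n : ℚ_[p]) • ((1 : ℚ_[p]) ⊗ₜ[ℚ] y) := by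
    rw [Nat.cast_smul_eq_nsmul, Nat.cast_smul_eq_nsmul]
  rw [h1, smul_smul, hes, TensorProduct.smul_tmul', smul_eq_mul, mul_one,
    ← eq_ratCast (algebraMap ℚ K) s, ← Algebra.smul_def, TensorProduct.tmul_smul,
    TensorProduct.smul_tmul', Algebra.smul_def, mul_one, eq_ratCast (algebraMap ℚ ℚ_[p]) s]

/-- Kato's character sum is `ℚ`-homogeneous in its argument: `Σ_b χ(b) ι(σ_b (s·x)) = s · Σ_b χ(b) ι(σ_b x)`
(`σ_b` and `ι` are ring homomorphisms, fixing `ℚ`). [cite: Kato2004Asterisque, Thm. 6.6 (1) (p. 163)] -/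
theorem charSum_ratCast_mul (m : ℕ) [NeZero m] (ιm : CyclotomicField m ℚ →+* ℂ)
    (χ : DirichletCharacter ℂ m) (s : ℚ) (y : CyclotomicField m ℚ) :
    charSum m ιm χ ((s : CyclotomicField m ℚ) * y) = (s : ℂ) * charSum m ιm χ y := by
  simp only [charSum, map_mul, map_ratCast, Finset.mul_sum]
  refine Finset.sum_congr rfl fun b _ ↦ ?_
  ring

/-- The character sum of `0` is `0`. [cite: Kato2004Asterisque, Thm. 6.6 (1) (p. 163)] -/
theorem charSum_zero (m : ℕ) [NeZero m] (ιm : CyclotomicField m ℚ →+* ℂ)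
    (χ : DirichletCharacter ℂ m) : charSum m ιm χ 0 = 0 := by
  simp only [charSum, map_zero, mul_zero, Finset.sum_const_zero]

end Scalars

section LevelRescaling

variable {W : WeierstrassCurve ℚ} [W.IsElliptic] {p : ℕ} [Fact p.Prime]
  [ContinuousSMul ℤ_[p] (W.tateModule p)] [Module.Free ℤ_[p] (W.tateModule p)]
  [Module.Finite ℤ_[p] (W.tateModule p)] {N : ℕ} {f : CuspForm (Gamma0 N) 2}
  {ι : (m : ℕ) → (CyclotomicField m ℚ →+* ℂ)} {κ : ℝ}
  {Λ : ∀ (k : ℕ) (r : Finset (HeightOneSpectrum (𝓞 ℚ))),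
    H1 (tateRep W p) (cycSubgroup p k r) →ₗ[ℤ_[p]] ℚ_[p] ⊗[ℚ] CyclotomicField (cycLevel p k r) ℚ}
  {c d a : ℤ} {A : ℕ}
  {z : ∀ (k : ℕ) (r : (cyclotomicLevelsRat p (badPlaces c d A N)).Ideals),
    H1 (tateRep W p) ((cyclotomicLevelsRat p (badPlaces c d A N)).level k r.1)}
  {x : ∀ (k : ℕ) (r : (cyclotomicLevelsRat p (badPlaces c d A N)).Ideals),
    CyclotomicField (cycLevel p k r.1) ℚ}

/-! ## §1 Level-wise rescaling of the value functionals -/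

/-- **Level-wise rescaling (the tree's zeta data have no cross-level axiom).**  Let `(κ, Λ, z, x)`
satisfy `ZetaBody W p f ι κ Λ c d a A z x`, and let `e_{k,r} ∈ ℚ_p` (one scalar per
level), `n ∈ ℕ`, `s ∈ ℚ` be such that `e_{k,r}·n = s` at every level whose value `x_{k,r}` is non-zero
— NO condition at the levels with `x_{k,r} = 0`.  Then `(s·κ, (e_{k,r} • Λ_{k,r})_{k,r}, n•z, s·x)`
satisfies `ZetaBody` again: (C1)/(C2) are `ℤ_p`-linear in `z` (`IsEulerSystem.smul`); (C3a)/(C3b) are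
stable under `ℚ_p`-scalars (`map_id_smul`); (C4) `e•Λ(n•z) = (e n)•(1 ⊗ x) = 1 ⊗ s·x`, trivially
`0 = 0` where `x = 0`; (C5) both sides scale by `s` (the new values are `s·x` at EVERY level).
PART 17c's `zetaBody_smul` is the case `e ≡ 1`, `s = n`.
[cite: Kato2004Asterisque, (8.1.3) (p. 180), §9.4 (p. 188), Thm. 9.7 (p. 189), Thm. 6.6 (1) (p. 163)] -/
theorem zetaBody_rescale (e : ℕ → Finset (HeightOneSpectrum (𝓞 ℚ)) → ℚ_[p])
    (n : ℕ) (s : ℚ)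
    (he : ∀ (k : ℕ) (r : (cyclotomicLevelsRat p (badPlaces c d A N)).Ideals),
      x k r = 0 ∨ e k r.1 * (n : ℚ_[p]) = (s : ℚ_[p]))
    (h : ZetaBody W p f ι κ Λ c d a A z x) :
    ZetaBody W p f ι ((s : ℝ) * κ) (fun k r ↦ e k r • Λ k r) c d a A ((n : ℤ_[p]) • z)
      (fun k r ↦ (s : CyclotomicField (cycLevel p k r.1) ℚ) * x k r) := by
  obtain ⟨h1, h2, h3a, h3b, h4, h5⟩ := h
  have hsκ : ((((s : ℝ) * κ : ℝ)) : ℂ) = (s : ℂ) * (κ : ℂ) := by push_cast; ring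
  refine ⟨h1.smul (n : ℤ_[p]), ?_, ?_, ?_, ?_, ?_⟩
  · -- (C2) unramifiedness is linear
    intro k r v hv 𝔓 h𝔓
    have h0 := h2 k r v hv 𝔓 h𝔓
    change (resLe (tateRep W p).toTopRep _ 1) ((n : ℤ_[p]) • z k r) = 0
    rw [map_smul, h0, smul_zero]
  · -- (C3a) equivariance is stable under `ℚ_p`-scalars
    intro k r σ y
    dsimp only
    rw [LinearMap.smul_apply, LinearMap.smul_apply, h3a k r σ y, map_id_smul]
  · -- (C3b) locality is stable under scalars
    intro k r y hy
    dsimp only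
    rw [LinearMap.smul_apply, h3b k r y hy, smul_zero]
  · -- (C4) rationality
    intro k r
    have hlin : Λ k r.1 (((n : ℤ_[p]) • z) k r) = (n : ℤ_[p]) • Λ k r.1 (z k r) :=
      (Λ k r.1).map_smul (n : ℤ_[p]) (z k r)
    dsimp only
    rw [LinearMap.smul_apply, hlin, h4 k r]
    rcases he k r with hx | hes
    · rw [hx, TensorProduct.tmul_zero, smul_zero, smul_zero, mul_zero, TensorProduct.tmul_zero]
    · exact smul_natCast_smul_one_tmul hes (x k r)
  · -- (C5) the value law scales by `s` on both sides
    intro k r d' χ Lχ hcd hd' hL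
    obtain ⟨heven, hodd⟩ := h5 k r d' χ Lχ hcd hd' hL
    dsimp only
    refine ⟨fun hχ ↦ ?_, fun hχ ↦ ?_⟩
    · rw [charSum_ratCast_mul, hsκ, heven hχ]
      ring
    · rw [charSum_ratCast_mul, hsκ, hodd hχ]
      ring

/-! ## §2 The bottom value, and its vanishing when `L_{(pA)}(f,1) = 0` -/

/-- **The bottom value vanishes when the depleted `L`-value does** (the rank-one situation).  If some
entire continuation `Lχ` of Kato's `(pA)`-depleted series `Σ_{(n,pA)=1} a_n n^{-s}` has `Lχ(1) = 0`
(in analytic rank one: `L(f,1) = 0`, the depletion factors being finite Euler factors — `1` at an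
additive `p`), then `x_{0,∅} = 0`: by (C5) at the trivial character of level `m = 1`,
`ι(x_{0,∅}) = κ · Lχ(1)/Ω⁺_f · R⁻ = 0` (tree `KatoValue.zetaBody_value_level_one`), and
`x_{0,∅} ∈ ℚ(ζ_1) = ℚ`.  (Guards `(cd, A) = 1`, `dd′ ≡ 1 (A)` as in (C5).)
[cite: Kato2004Asterisque, Thm. 9.7 (p. 189) and Thm. 6.6 (1) (p. 163)] -/
theorem bottomValue_eq_zero_of_depletedL_one_eq_zero (h : ZetaBody W p f ι κ Λ c d a A z x)
    (d' : ℤ) (hcd : Int.gcd (c * d) A = 1) (hdd' : d * d' ≡ 1 [ZMOD (A : ℤ)]) {Lχ : ℂ → ℂ}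
    (hL : IsDepletedTwistedL f (cycLevel p 0 ∅) (p * A) (1 : DirichletCharacter ℂ (cycLevel p 0 ∅)) Lχ)
    (hL1 : Lχ 1 = 0) :
    x 0 (cyclotomicLevelsRat p (badPlaces c d A N)).idealOne = 0 := by
  obtain ⟨r₀, hr₀, -, hval⟩ :=
    Rank1Residual.GaloisImage.KatoValue.zetaBody_value_level_one h d' hcd hdd' hL
  rw [hL1, zero_div, mul_zero, zero_mul, Rat.cast_eq_zero] at hval
  rw [← hr₀, hval, map_zero]

/-! ## §3 Rank-one decoupling: the classes scale with `κ` and `Λ_{0,∅}` fixed -/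

/-- **RANK-ONE DECOUPLING.**  If `(κ, Λ, z, x)` satisfies `ZetaBody` and the bottom value
vanishes (`x_{0,∅} = 0`, e.g. `L(f,1) = 0`: `bottomValue_eq_zero_of_depletedL_one_eq_zero`), then for
every `n ≠ 0` the datum with the SAME constant `κ`, the SAME values `x`, the SAME bottom functional
`Λ_{0,∅}` and the functionals `n⁻¹ • Λ_{k,r}` at the levels `m > 1`, but with ALL CLASSES SCALED
`z ↦ n•z`, satisfies `ZetaBody` again (`zetaBody_rescale` with `e = (1 at the bottom, n⁻¹ elsewhere)`, `s = 1`: at the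
bottom `x_{0,∅} = 0`, elsewhere `n⁻¹·n = 1`; the scalar family is written as an `if`).  With
`ZetaBodyScaling.zetaLift_smul` the `Λ`-adic lift
becomes `n•𝐲`, so `pos(𝐲₀)` shifts by `v_p n` while `(κ, Λ_{0,∅})` — the only data a bottom-level
normalisation clause can mention — do not move: such clauses cannot pin Perrin-Riou's ratio.
[cite: Kato2004Asterisque, §9.4 (p. 188), Thm. 9.7 (p. 189), Thm. 6.6 (1) (p. 163), §13.1 (p. 224)]
[cite: BurnsKuriharaSano2019, Hyp. 2.2 and Remark 2.3 (p. 9)] -/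
theorem zetaBody_smul_offBottom {n : ℕ} (hn : n ≠ 0)
    (hx0 : x 0 (cyclotomicLevelsRat p (badPlaces c d A N)).idealOne = 0)
    (h : ZetaBody W p f ι κ Λ c d a A z x) :
    ZetaBody W p f ι κ
      (fun k r ↦ (if k = 0 ∧ r = ∅ then (1 : ℚ_[p]) else (n : ℚ_[p])⁻¹) • Λ k r)
      c d a A ((n : ℤ_[p]) • z) x := by
  have hnp : (n : ℚ_[p]) ≠ 0 := by exact_mod_cast hn
  have he : ∀ (k : ℕ) (r : (cyclotomicLevelsRat p (badPlaces c d A N)).Ideals),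
      x k r = 0 ∨ (if k = 0 ∧ r.1 = ∅ then (1 : ℚ_[p]) else (n : ℚ_[p])⁻¹) * (n : ℚ_[p]) =
        ((1 : ℚ) : ℚ_[p]) := by
    intro k r
    by_cases hb : k = 0 ∧ r.1 = ∅
    · left
      obtain ⟨rfl, hr⟩ := hb
      have hr' : r = (cyclotomicLevelsRat p (badPlaces c d A N)).idealOne := Subtype.ext hr
      subst hr'
      exact hx0
    · right
      rw [if_neg hb, Rat.cast_one, inv_mul_cancel₀ hnp]
  have h' := zetaBody_rescale (fun k r ↦ if k = 0 ∧ r = ∅ then (1 : ℚ_[p]) else (n : ℚ_[p])⁻¹)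
    n 1 he h
  simp only [Rat.cast_one, one_mul] at h'
  exact h'

omit [Module.Free ℤ_[p] (W.tateModule p)] [Module.Finite ℤ_[p] (W.tateModule p)] in
/-- The family of functionals in `zetaBody_smul_offBottom` AGREES with `Λ` at the bottom level.
[folklore] -/
theorem offBottom_smul_bottom (t : ℚ_[p]) :
    (fun (k : ℕ) (r : Finset (HeightOneSpectrum (𝓞 ℚ))) ↦
        (if k = 0 ∧ r = ∅ then (1 : ℚ_[p]) else t) • Λ k r) 0 ∅ = Λ 0 ∅ := by
  simp only [and_self, if_true, one_smul]

/-- **Existential form of the decoupling**: same `κ`, same `x`, same `Λ_{0,∅}`, classes `n•z`.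
[cite: Kato2004Asterisque, §9.4 (p. 188), Thm. 9.7 (p. 189), Thm. 6.6 (1) (p. 163)] -/
theorem exists_zetaBody_smul_fixing_bottom {n : ℕ} (hn : n ≠ 0)
    (hx0 : x 0 (cyclotomicLevelsRat p (badPlaces c d A N)).idealOne = 0)
    (h : ZetaBody W p f ι κ Λ c d a A z x) :
    ∃ Λ' : ∀ (k : ℕ) (r : Finset (HeightOneSpectrum (𝓞 ℚ))),
        H1 (tateRep W p) (cycSubgroup p k r) →ₗ[ℤ_[p]] ℚ_[p] ⊗[ℚ] CyclotomicField (cycLevel p k r) ℚ,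
      Λ' 0 ∅ = Λ 0 ∅ ∧ ZetaBody W p f ι κ Λ' c d a A ((n : ℤ_[p]) • z) x :=
  ⟨_, offBottom_smul_bottom _, zetaBody_smul_offBottom hn hx0 h⟩

/-! ## §4 Rank-one decoupling: the bottom functional is free -/

/-- **The bottom functional is constrained by nothing but (C3a), (C3b) and `Λ(z_{0,∅}) = 0`.**  If the
bottom value vanishes, `Λ_{0,∅}` may be REPLACED by any family member `Λ♯_{0,∅}` that is
`Gal`-equivariant (C3a), local at `p` (C3b) and kills `z_{0,∅}` — the other levels, `κ`, `z`, `x`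
unchanged.  (So a DEFINED `exp*_ω ∘ loc_p` could be substituted at the bottom level — in analytic rank
one it kills `z_{0,∅}`, all global classes being finite at `p` rationally — without constraining the
rest of the datum.) [cite: Kato2004Asterisque, §9.4 (p. 188), Thm. 9.7 (p. 189), Thm. 6.6 (1) (p. 163)] -/
theorem zetaBody_replaceBottom
    (hx0 : x 0 (cyclotomicLevelsRat p (badPlaces c d A N)).idealOne = 0)
    (Λ' : ∀ (k : ℕ) (r : Finset (HeightOneSpectrum (𝓞 ℚ))),
      H1 (tateRep W p) (cycSubgroup p k r) →ₗ[ℤ_[p]] ℚ_[p] ⊗[ℚ] CyclotomicField (cycLevel p k r) ℚ)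
    (hagree : ∀ (k : ℕ) (r : Finset (HeightOneSpectrum (𝓞 ℚ))), ¬ (k = 0 ∧ r = ∅) → Λ' k r = Λ k r)
    (h3a0 : ∀ (σ : absoluteGaloisGroup ℚ) (y : H1 (tateRep W p) (cycSubgroup p 0 ∅)),
      Λ' 0 ∅ (conjMap (tateRep W p).toTopRep (cycSubgroup p 0 ∅) σ 1 y) =
        Algebra.TensorProduct.map (AlgHom.id ℚ ℚ_[p])
          (sigma (cycLevel p 0 ∅) (modNCyclotomicCharacter ℚ (cycLevel p 0 ∅) σ) :
            CyclotomicField (cycLevel p 0 ∅) ℚ →ₐ[ℚ] CyclotomicField (cycLevel p 0 ∅) ℚ)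
          (Λ' 0 ∅ y))
    (h3b0 : ∀ y : H1 (tateRep W p) (cycSubgroup p 0 ∅),
      (∀ v : HeightOneSpectrum (𝓞 ℚ), ((primesEquiv v : Nat.Primes) : ℕ) = p →
        ∀ 𝔓 ∈ v.primesAbove,
          resLe (tateRep W p).toTopRep
              (inf_le_left : cycSubgroup p 0 ∅ ⊓ MulAction.stabilizer (absoluteGaloisGroup ℚ) 𝔓 ≤
                cycSubgroup p 0 ∅)
              1 y = 0) →
      Λ' 0 ∅ y = 0)
    (h40 : Λ' 0 ∅ (z 0 (cyclotomicLevelsRat p (badPlaces c d A N)).idealOne) = 0)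
    (h : ZetaBody W p f ι κ Λ c d a A z x) :
    ZetaBody W p f ι κ Λ' c d a A z x := by
  obtain ⟨h1, h2, h3a, h3b, h4, h5⟩ := h
  refine ⟨h1, h2, ?_, ?_, ?_, h5⟩
  · intro k r σ y
    by_cases hb : k = 0 ∧ r = ∅
    · obtain ⟨rfl, rfl⟩ := hb
      exact h3a0 σ y
    · rw [hagree k r hb]
      exact h3a k r σ y
  · intro k r y hy
    by_cases hb : k = 0 ∧ r = ∅
    · obtain ⟨rfl, rfl⟩ := hb
      exact h3b0 y hy
    · rw [hagree k r hb]
      exact h3b k r y hy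
  · intro k r
    by_cases hb : k = 0 ∧ r.1 = ∅
    · obtain ⟨rfl, hr⟩ := hb
      have hr' : r = (cyclotomicLevelsRat p (badPlaces c d A N)).idealOne := Subtype.ext hr
      subst hr'
      rw [hx0, TensorProduct.tmul_zero]
      exact h40
    · rw [hagree k r.1 hb]
      exact h4 k r

/-- **The bottom functional rescales freely** (corollary of `zetaBody_rescale` with `n = 1`, `s = 1`,
`e = (t at the bottom, 1 elsewhere)`): if `x_{0,∅} = 0` then `Λ_{0,∅}` may be replaced by `t • Λ_{0,∅}` for ANY
`t ∈ ℚ_p` — including `t = 0` and `t = p^{±k}` — with `κ`, `z`, `x` and all other functionals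
unchanged.  Any «image-lattice» or «adjointness» normalisation of `Λ_{0,∅}` alone is therefore
decoupled from the rest of the datum in analytic rank one.
[cite: Kato2004Asterisque, §9.4 (p. 188), Thm. 9.7 (p. 189), Thm. 6.6 (1) (p. 163)] -/
theorem zetaBody_bottom_smul (t : ℚ_[p])
    (hx0 : x 0 (cyclotomicLevelsRat p (badPlaces c d A N)).idealOne = 0)
    (h : ZetaBody W p f ι κ Λ c d a A z x) :
    ZetaBody W p f ι κ
      (fun k r ↦ (if k = 0 ∧ r = ∅ then t else (1 : ℚ_[p])) • Λ k r) c d a A z x := by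
  have he : ∀ (k : ℕ) (r : (cyclotomicLevelsRat p (badPlaces c d A N)).Ideals),
      x k r = 0 ∨ (if k = 0 ∧ r.1 = ∅ then t else (1 : ℚ_[p])) * ((1 : ℕ) : ℚ_[p]) =
        ((1 : ℚ) : ℚ_[p]) := by
    intro k r
    by_cases hb : k = 0 ∧ r.1 = ∅
    · left
      obtain ⟨rfl, hr⟩ := hb
      have hr' : r = (cyclotomicLevelsRat p (badPlaces c d A N)).idealOne := Subtype.ext hr
      subst hr'
      exact hx0
    · right
      rw [if_neg hb, Nat.cast_one, Rat.cast_one, one_mul]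
  have h' := zetaBody_rescale (fun k r ↦ if k = 0 ∧ r = ∅ then t else (1 : ℚ_[p])) 1 1 he h
  simp only [Rat.cast_one, one_mul, Nat.cast_one, one_smul] at h'
  exact h'

omit [Module.Free ℤ_[p] (W.tateModule p)] [Module.Finite ℤ_[p] (W.tateModule p)] in
/-- The family of `zetaBody_bottom_smul` at the bottom level is `t • Λ_{0,∅}`; for `t = 0` the bottom
functional is ZERO. [folklore] -/
theorem atBottom_smul_bottom (t : ℚ_[p]) :
    (fun (k : ℕ) (r : Finset (HeightOneSpectrum (𝓞 ℚ))) ↦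
        (if k = 0 ∧ r = ∅ then t else (1 : ℚ_[p])) • Λ k r) 0 ∅ = t • Λ 0 ∅ := by
  simp only [and_self, if_true]

/-- **The pair `(κ, Λ_{0,∅})` carries no constraint on the scale of the classes** (§3 and §4
combined): for `x_{0,∅} = 0`, every `n ≠ 0` and every `t ∈ ℚ_p` there is a functional family
`Λ'` with `Λ'_{0,∅} = t • Λ_{0,∅}` such that `(κ, Λ', n•z, x)` satisfies `ZetaBody`.
[cite: Kato2004Asterisque, §9.4 (p. 188), Thm. 9.7 (p. 189), Thm. 6.6 (1) (p. 163)] -/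
theorem exists_zetaBody_smul_bottom_smul {n : ℕ} (hn : n ≠ 0) (t : ℚ_[p])
    (hx0 : x 0 (cyclotomicLevelsRat p (badPlaces c d A N)).idealOne = 0)
    (h : ZetaBody W p f ι κ Λ c d a A z x) :
    ∃ Λ' : ∀ (k : ℕ) (r : Finset (HeightOneSpectrum (𝓞 ℚ))),
        H1 (tateRep W p) (cycSubgroup p k r) →ₗ[ℤ_[p]] ℚ_[p] ⊗[ℚ] CyclotomicField (cycLevel p k r) ℚ,
      Λ' 0 ∅ = t • Λ 0 ∅ ∧ ZetaBody W p f ι κ Λ' c d a A ((n : ℤ_[p]) • z) x := by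
  refine ⟨fun k r ↦ (if k = 0 ∧ r = ∅ then t else (1 : ℚ_[p])) •
      ((if k = 0 ∧ r = ∅ then (1 : ℚ_[p]) else (n : ℚ_[p])⁻¹) • Λ k r), ?_, ?_⟩
  · simp only [and_self, if_true, one_smul]
  · exact zetaBody_bottom_smul t hx0 (zetaBody_smul_offBottom hn hx0 h)

end LevelRescaling

end Summit.BirchSwinnertonDyer.BirchSwinnertonDyer.Theorems.ZetaBodyScaling

end
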